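import Summits.SmoothPoincare4.SmoothPoincare4.Theorems.EntropyRungSubcylindricalExistenceTransport
import Summits.SmoothPoincare4.SmoothPoincare4.Theorems.EntropyRungSubcylindricalExistenceTheoremA
import Summits.SmoothPoincare4.SmoothPoincare4.Theorems.EntropyRungSubcylindricalExistenceSchwarzschildReduction
import Summits.SmoothPoincare4.SmoothPoincare4.Theorems.EntropyRungSubcylindricalExistenceSphereWitness
import Summits.SmoothPoincare4.SmoothPoincare4.Theorems.EntropyRungSubcylindricalExistenceConeCoreReduction
import Summits.SmoothPoincare4.SmoothPoincare4.Theorems.EntropyRungSubcylindricalExistenceConeCoreWitness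
import Summits.SmoothPoincare4.SmoothPoincare4.Theorems.SubcylindricalExistence.Negative.Logic
import Summits.SmoothPoincare4.SmoothPoincare4.Theorems.SubcylindricalExistence.Negative.SchwarzschildBlowupExistence
import Summits.SmoothPoincare4.SmoothPoincare4.Theorems.SubcylindricalExistence.Negative.ConeCoreExistence
import Summits.SmoothPoincare4.SmoothPoincare4.Theorems.SubcylindricalExistence.Negative.BlowupExistence

/-!
# Line-death certificates for crux `EntropyRung.SubcylindricalExistence` (stmt-SmoothPoincare4-10871, "ENT")
# — lead c7 (eighth lead seat), 2026-08-17

Kernel-checked bookkeeping behind the `Lines/<slug>.dead.md` files of this seat. Nothing here is new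
mathematics: every proof is a one-line appeal to a theorem ALREADY LANDED in `Theorems/` by leads c0–c6 and the
standing disprover. The point of the file is that it ELABORATES (rc 0, 0 sorry): the cited declarations exist with
exactly the shapes claimed in the dead-line dossier.

* §0  `crux_iff_spc4` — ENT ⇔ SPC4 given the route's own rung; `spc4_imp_crux` — SPC4 → ENT outright.
* §1  the general costume lemma: ANY sufficient condition `C` for ENT (the transfer stub of any line) implies SPC4
      given the rung, and is refuted by an exotic 4-sphere given the rung (`transfer_imp_spc4`,
      `not_transfer_of_exotic`). So a line for ENT survives only if its transfer stub carries an SPC4-independent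
      construction — none of the nine payload lines does (dossier).
* §2  line `curvature-dimension-entropy-floor`: transfer stub D (`StubD`, = registered
      `subcylindricalExistence_of_ricciFatMetric`'s hypothesis = route item RicciFat.RicciFatSphere's clause):
      D → ENT (landed reduction), D ↔ SPC4 given the rung, D holds on Mathlib's `S⁴`.
* §3  line `green-blowup-conformal-entropy`: transfer stub Â_b (`StubAb` = registered
      `stub_schwarzschildBlowupExistence`, verbatim): Â_b → ENT, Â_b → SPC4 given the rung, Â_b's body on `S⁴`.
* §4  line `fat-conical-core-avr-logsobolev`: transfer stub T (`StubT` = registered `stub_coneCoreExistence`,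
      verbatim) and the named fact BKT (`StubBKT` = registered `stub_bktLogSobolevAVRFour` =
      `Literature.Geometry.Riemannian.sharpLogSobolevAVR_four`): BKT → T → ENT, T → SPC4 given rung + BKT,
      T's body on `S⁴`.
* §5  line `ekeland-stable-shrinker` (and every future line): instance of §1 for a three-stub composition.
-/

noncomputable section

-- the crux-folder namespace repeats the summit component (`Summit.SmoothPoincare4.SmoothPoincare4.…`)
set_option linter.dupNamespace false

open scoped Manifold ContDiff Topology ENNReal NNReal ContinuousMap RealInnerProductSpace
open Set Filter Function MeasureTheory
open Literature.Geometry.Lorentzian Literature.Geometry.Riemannian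
open Summit.SmoothPoincare4.SmoothPoincare4.Theses.EntropyRung

namespace Summit.SmoothPoincare4.SmoothPoincare4.Cruxes.SubcylindricalExistence.LineDead

/-! ## §0 The crux is SPC4 given the rung -/

/-- ENT ⇔ SPC4 given `SubcylindricalRecognition` (Transport, p96669). -/
theorem crux_iff_spc4 (hRung : SubcylindricalRecognition) :
    SubcylindricalExistence ↔ _root_.SmoothPoincare4 :=
  _root_.Summit.SmoothPoincare4.SmoothPoincare4.Theorems.subcylindricalExistence_iff_spc4 hRung

/-- SPC4 → ENT, unconditionally (round metric transported along `M ≃ₘ S⁴`; Transport, p96669). -/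
theorem spc4_imp_crux : _root_.SmoothPoincare4 → SubcylindricalExistence :=
  _root_.Summit.SmoothPoincare4.SmoothPoincare4.Theorems.subcylindricalExistence_of_spc4

/-! ## §1 The costume lemma: every transfer stub of every line for ENT is SPC4-hard given the rung -/

/-- If `C` implies the crux (the composition `SubcylindricalExistence_of` of any checked line, fed by its transfer
stub `C` and its landed soft stubs), then `C` implies SPC4 as soon as the rung holds. -/
theorem transfer_imp_spc4 (hRung : SubcylindricalRecognition) {C : Prop}
    (hline : C → SubcylindricalExistence) : C → _root_.SmoothPoincare4 :=
  fun hC ↦ closes hRung (hline hC)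

/-- … and an exotic 4-sphere refutes `C` given the rung. -/
theorem not_transfer_of_exotic (hRung : SubcylindricalRecognition) {C : Prop}
    (hline : C → SubcylindricalExistence) (hex : ¬ _root_.SmoothPoincare4) : ¬ C :=
  fun hC ↦ hex (transfer_imp_spc4 hRung hline hC)

/-- Conversely a transfer stub that SPC4 implies is, given the rung, EQUIVALENT to SPC4: it has no content
independent of the summit. -/
theorem transfer_iff_spc4 (hRung : SubcylindricalRecognition) {C : Prop}
    (hline : C → SubcylindricalExistence) (hconv : _root_.SmoothPoincare4 → C) : C ↔ _root_.SmoothPoincare4 :=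
  ⟨transfer_imp_spc4 hRung hline, hconv⟩

/-! ## §2 Line `curvature-dimension-entropy-floor` — transfer stub D -/

/-- Transfer stub D of line `curvature-dimension-entropy-floor` (hypothesis of the registered, landed reduction
`subcylindricalExistence_of_ricciFatMetric`; = the clause of route item RicciFat.RicciFatSphere, stmt-5192). -/
def StubD : Prop :=
  ∀ (M : Type) [TopologicalSpace M] [T2Space M] [SecondCountableTopology M] [ChartedSpace (EuclideanSpace ℝ (Fin 4)) M] [IsManifold (𝓡 4) ∞ M] [CompactSpace M] [T3Space M] [MeasurableSpace M] [BorelSpace M], M ≃ₕ Metric.sphere (0 : EuclideanSpace ℝ (Fin 5)) 1 → ∃ g : PseudoRiemannianMetric (𝓡 4) ∞ (EuclideanSpace ℝ (Fin 4)) (TangentSpace (𝓡 4) : M → Type _), ∃ _ : g.HasLeviCivita, ∃ hg : g.IsRiemannian, (∀ (x : M) (v : TangentSpace (𝓡 4) x), 3 * g.val x v v ≤ g.ricci x v v) ∧ Real.sqrt Real.pi * Real.exp (1 / 2 : ℝ) / 3 * (8 * Real.pi ^ 2 / 3) < (riemannianMeasure (g.toContMDiffRiemannianMetric hg) Set.u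niv).toReal

/-- D → ENT (Theorem A chain, landed p82880). -/
theorem lineD_closed_modulo : StubD → SubcylindricalExistence :=
  _root_.Summit.SmoothPoincare4.SmoothPoincare4.Theorems.subcylindricalExistence_of_ricciFatMetric

/-- D ↔ SPC4 given the rung (Transport, p96669). -/
theorem lineD_stub_iff_spc4 (hRung : SubcylindricalRecognition) : StubD ↔ _root_.SmoothPoincare4 :=
  _root_.Summit.SmoothPoincare4.SmoothPoincare4.Theorems.ricciFatMetric_iff_spc4 hRung

/-- SPC4 → D (so D has no SPC4-independent content). -/
theorem lineD_stub_of_spc4 : _root_.SmoothPoincare4 → StubD :=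
  _root_.Summit.SmoothPoincare4.SmoothPoincare4.Theorems.ricciFatMetric_of_spc4

/-! ## §3 Line `green-blowup-conformal-entropy` — transfer stub Â_b (Schwarzschild gauge, reshape R-c3) -/

/-- Transfer stub Â_b = registered `stub_schwarzschildBlowupExistence`, VERBATIM. -/
def StubAb : Prop :=
  ∀ (M : Type) [TopologicalSpace M] [T2Space M] [SecondCountableTopology M] [ChartedSpace (EuclideanSpace ℝ (Fin 4)) M] [IsManifold (𝓡 4) ∞ M] [CompactSpace M] [T3Space M] [MeasurableSpace M] [BorelSpace M], M ≃ₕ Metric.sphere (0 : EuclideanSpace ℝ (Fin 5)) 1 → ∃ g : PseudoRiemannianMetric (𝓡 4) ∞ (EuclideanSpace ℝ (Fin 4)) (TangentSpace (𝓡 4) : M → Type _), ∃ _ : g.HasLeviCivita, ∃ hg : g.IsRiemannian, ∃ p : M, ∃ G : M → ℝ, ∃ a b r : ℝ, (ContMDiffOn (𝓡 4) 𝓘(ℝ, ℝ) ∞ G {p}ᶜ ∧ (∀ x, x ≠ p → 0 < G x) ∧ (∀ x, x ≠ p → g.scalarCurvature x * G x - 6 * g.dalembertian G x = 0) ∧ Tendsto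 G (𝓝[≠] p) atTop) ∧ (∀ x, 0 ≤ g.scalarCurvature x) ∧ (∀ x, g.scalarCurvature x = 0 → x ∈ (extChartAt (𝓡 4) p).source ∧ extChartAt (𝓡 4) p x ∈ Metric.closedBall (extChartAt (𝓡 4) p p) r) ∧ 0 < a ∧ 0 ≤ b ∧ 0 < r ∧ (Metric.closedBall (extChartAt (𝓡 4) p p) r ⊆ (extChartAt (𝓡 4) p).target ∧ ∀ y ∈ Metric.closedBall (extChartAt (𝓡 4) p p) r, ∀ X W : EuclideanSpace ℝ (Fin 4), g.val ((extChartAt (𝓡 4) p).symm y) (mfderiv 𝓘(ℝ, EuclideanSpace ℝ (Fin 4)) (𝓡 4) (extChartAt (𝓡 4) p).symm y X) (mfderiv 𝓘(ℝ, EuclideanSpace ℝ (Fin 4)) (𝓡 4) (extChartAt (𝓡 4) p).symm y W) = ⟪X, W⟫) ∧ (∀ y ∈ Metric.closedBall (extChartAt (𝓡 4) p p) r, y ≠ extChartAt (𝓡 4) p p → G ((extChartAt (𝓡 4) p).symm y) = a / ‖y - extChartAt (𝓡 4) p p‖ ^ 2 + b) ∧ ∃ δ : ℝ, 0 < δ ∧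 ∀ τ : ℝ, 0 < τ → ∀ w : M → ℝ, ContMDiff (𝓡 4) 𝓘(ℝ, ℝ) ∞ w → w =ᶠ[𝓝 p] 0 → ∫ x, (4 * Real.pi * τ) ^ (-(4 : ℝ) / 2) * (w x) ^ 2 * (G x) ^ 4 ∂(riemannianMeasure (g.toContMDiffRiemannianMetric hg)) = 1 → Real.log 2 + Real.log Real.pi / 2 - 3 / 2 + δ ≤ ∫ x, (4 * τ * ((G x)⁻¹ ^ 2 * g.gradSq w x) - (w x) ^ 2 * Real.log ((w x) ^ 2) - 4 * (w x) ^ 2) * ((4 * Real.pi * τ) ^ (-(4 : ℝ) / 2) * (G x) ^ 4) ∂(riemannianMeasure (g.toContMDiffRiemannianMetric hg))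

/-- Â_b → ENT (landed reduction `subcylindricalExistence_of_schwarzschildBlowupExistence`, p127092). -/
theorem lineAb_closed_modulo : StubAb → SubcylindricalExistence :=
  _root_.Summit.SmoothPoincare4.SmoothPoincare4.Theorems.subcylindricalExistence_of_schwarzschildBlowupExistence

/-- Â_b → SPC4 given the rung (Negative/SchwarzschildBlowupExistence, p135162). -/
theorem lineAb_stub_imp_spc4 (hRung : SubcylindricalRecognition) : StubAb → _root_.SmoothPoincare4 :=
  Summit.SmoothPoincare4.Cruxes.SubcylindricalExistence.Negative.spc4_of_schwarzschildBlowupExistence hRung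

/-- ¬SPC4 → ¬Â_b given the rung. -/
theorem lineAb_not_stub_of_exotic (hRung : SubcylindricalRecognition) (hex : ¬ _root_.SmoothPoincare4) :
    ¬ StubAb :=
  not_transfer_of_exotic hRung lineAb_closed_modulo hex

/-- Â_b's body holds on Mathlib's `S⁴` (witness p135257): the stub is not false — it is SPC4-hard, not dead by
refutation. -/
example := @_root_.Summit.SmoothPoincare4.SmoothPoincare4.Theorems.helper_schwarzschildBlowupExistence_sphereFour

/-! ## §4 Line `fat-conical-core-avr-logsobolev` — transfer stub T + named fact BKT -/

/-- Named fact B = registered `stub_bktLogSobolevAVRFour`, VERBATIM (Balogh–Kristály–Tripaldi sharp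
log-Sobolev under `Ric ≥ 0` and `AVR = θ`, W-form; = `Literature.Geometry.Riemannian.sharpLogSobolevAVR_four`). -/
def StubBKT : Prop :=
  ∀ (P : Type) [TopologicalSpace P] [T2Space P] [SecondCountableTopology P] [ChartedSpace (EuclideanSpace ℝ (Fin 4)) P] [IsManifold (𝓡 4) ∞ P] [ConnectedSpace P] [T3Space P] [MeasurableSpace P] [BorelSpace P] (h : PseudoRiemannianMetric (𝓡 4) ∞ (EuclideanSpace ℝ (Fin 4)) (TangentSpace (𝓡 4) : P → Type _)) [h.HasLeviCivita] (hh : h.IsRiemannian) (θ : ℝ), (∀ (x : P) (r : NNReal), IsCompact {y : P | h.edist hh x y ≤ r}) → (∀ (x : P) (X : TangentSpace (𝓡 4) x), 0 ≤ h.ricci x X X) → 0 < θ → (∀ x : P, Tendsto (fun r : ℝ ↦ ((riemannianMeasure (h.toContMDiffRiemannianMetric hh)) {y : P | h.edist hh x y ≤ ENNReal.ofReal r}).toReal / (Real.pi ^ 2 / 2 * r ^ 4)) atTop (𝓝 θ)) → ∀ u : P → ℝ, ContMDiff (𝓡 4) 𝓘(ℝ, ℝ) ∞ u → HasCompactSupport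 u → ∫ x, (u x) ^ 2 ∂(riemannianMeasure (h.toContMDiffRiemannianMetric hh)) = 1 → ∀ τ : ℝ, 0 < τ → ∫ x, (u x) ^ 2 * Real.log ((u x) ^ 2) ∂(riemannianMeasure (h.toContMDiffRiemannianMetric hh)) ≤ 4 * τ * ∫ x, h.gradSq u x ∂(riemannianMeasure (h.toContMDiffRiemannianMetric hh)) - Real.log θ - 2 * Real.log (4 * Real.pi * τ) - 4

/-- B is literally the Literature named fact. -/
theorem stubBKT_iff : StubBKT ↔ Literature.Geometry.Riemannian.sharpLogSobolevAVR_four := Iff.rfl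

/-- Transfer stub T = registered `stub_coneCoreExistence`, VERBATIM. -/
def StubT : Prop :=
  ∀ (M : Type) [TopologicalSpace M] [T2Space M] [SecondCountableTopology M] [ChartedSpace (EuclideanSpace ℝ (Fin 4)) M] [IsManifold (𝓡 4) ∞ M] [CompactSpace M] [T3Space M] [MeasurableSpace M] [BorelSpace M], M ≃ₕ Metric.sphere (0 : EuclideanSpace ℝ (Fin 5)) 1 → ∃ g : PseudoRiemannianMetric (𝓡 4) ∞ (EuclideanSpace ℝ (Fin 4)) (TangentSpace (𝓡 4) : M → Type _), ∃ _ : g.HasLeviCivita, ∃ _ : g.IsRiemannian, ∃ (p : M) (r : ℝ) (Λ : M → ℝ) (c : ℝ) (P : Type) (_ : TopologicalSpace P) (_ : T2Space P) (_ : SecondCountableTopology P) (_ : ChartedSpace (EuclideanSpace ℝ (Fin 4)) P) (_ : IsManifold (𝓡 4) ∞ P) (_ : ConnectedSpace P) (_ : NoncompactSpace P) (_ : T3Space P) (_ : MeasurableSpace P) (_ : BorelSpace P) (h : PseudoRiemannianMetric (𝓡 4) ∞ (EuclideanSpace ℝ (Fin 4)) (TangentSpace (𝓡 4) : P → Type _))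 (_ : h.HasLeviCivita) (hh : h.IsRiemannian) (ι : P → M) (σ : M → P), (Metric.closedBall (extChartAt (𝓡 4) p p) r ⊆ (extChartAt (𝓡 4) p).target ∧ ∀ y ∈ Metric.closedBall (extChartAt (𝓡 4) p p) r, ∀ X W : EuclideanSpace ℝ (Fin 4), g.val ((extChartAt (𝓡 4) p).symm y) (mfderiv 𝓘(ℝ, EuclideanSpace ℝ (Fin 4)) (𝓡 4) (extChartAt (𝓡 4) p).symm y X) (mfderiv 𝓘(ℝ, EuclideanSpace ℝ (Fin 4)) (𝓡 4) (extChartAt (𝓡 4) p).symm y W) = ⟪X, W⟫) ∧ (ContMDiffOn (𝓡 4) 𝓘(ℝ, ℝ) ∞ Λ {p}ᶜ ∧ (∀ x, x ≠ p → 0 < Λ x) ∧ ∀ y ∈ Metric.closedBall (extChartAt (𝓡 4) p p) r, y ≠ extChartAt (𝓡 4) p p → Λ ((extChartAt (𝓡 4) p).symm y) = c * ‖y - extChartAt (𝓡 4) p p‖ ^ (-(c + 1))) ∧ (ContMDiff (𝓡 4) (𝓡 4) ∞ ι ∧ Injective ι ∧ (∀ q : P, Injective (mfderiv (𝓡 4)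 (𝓡 4) ι q)) ∧ range ι = {p}ᶜ ∧ ContMDiffOn (𝓡 4) (𝓡 4) ∞ σ {p}ᶜ ∧ (∀ q : P, σ (ι q) = q) ∧ (∀ x : M, x ≠ p → ι (σ x) = x) ∧ ∀ (q : P) (v w : TangentSpace (𝓡 4) q), h.val q v w = Λ (ι q) ^ 2 * g.val (ι q) (mfderiv (𝓡 4) (𝓡 4) ι q v) (mfderiv (𝓡 4) (𝓡 4) ι q w)) ∧ ((∀ (x : P) (r : NNReal), IsCompact {y : P | h.edist hh x y ≤ r}) ∧ (∀ (x : P) (X : TangentSpace (𝓡 4) x), 0 ≤ h.ricci x X X) ∧ ∀ x : P, Tendsto (fun r : ℝ ↦ ((riemannianMeasure (h.toContMDiffRiemannianMetric hh)) {y : P | h.edist hh x y ≤ ENNReal.ofReal r}).toReal / (Real.pi ^ 2 / 2 * r ^ 4)) atTop (𝓝 (c ^ 3))) ∧ (0 < r ∧ 0 < c ∧ c ≤ 1) ∧ 2 * Real.sqrt Real.pi * Real.exp (-(3 : ℝ) / 2) < c ^ 3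

/-- B → T → ENT (landed reduction `helper_subcylindricalExistence_of_coneCore`, p132897). -/
theorem lineT_closed_modulo : StubBKT → StubT → SubcylindricalExistence :=
  fun hB hT ↦ _root_.Summit.SmoothPoincare4.SmoothPoincare4.Theorems.helper_subcylindricalExistence_of_coneCore hB hT

/-- T → SPC4 given the rung and B (Negative/ConeCoreExistence, p135941). -/
theorem lineT_stub_imp_spc4 (hRung : SubcylindricalRecognition) (hB : StubBKT) : StubT → _root_.SmoothPoincare4 :=
  Summit.SmoothPoincare4.Cruxes.SubcylindricalExistence.Negative.spc4_of_coneCoreExistence hRung hB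

/-- T's body holds on Mathlib's `S⁴` (witness p136261). -/
example := @_root_.Summit.SmoothPoincare4.SmoothPoincare4.Theorems.helper_coneCoreExistence_sphereFour

/-! ## §5 Line `ekeland-stable-shrinker` (never led; stubs S, R, A open even on `S⁴`) and any future line -/

/-- For a line whose checked composition is `S → R → A → ENT` (ekeland: `stub_maximiserIsShrinker`,
`stub_maximiserRigidity`, `stub_compactnessModNecks`; `stub_staticLinearHeat` is landed), the conjunction of its
open stubs implies SPC4 given the rung. (Its stubs are NOT implied by SPC4: attainment of `sup ν` over PSC
metrics and uniqueness of the maximiser are open on the standard `S⁴`.) -/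
theorem threeStubLine_imp_spc4 (hRung : SubcylindricalRecognition) {S R A : Prop}
    (hcomp : S → R → A → SubcylindricalExistence) : S ∧ R ∧ A → _root_.SmoothPoincare4 :=
  fun h ↦ transfer_imp_spc4 hRung (fun (k : S ∧ R ∧ A) ↦ hcomp k.1 k.2.1 k.2.2) h

end Summit.SmoothPoincare4.SmoothPoincare4.Cruxes.SubcylindricalExistence.LineDead

end
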